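import Summits.NavierStokesRegularity.NavierStokesRegularity.Theorems.WakeRatchetAdmissibleEternalBoundCritical
import Summits.NavierStokesRegularity.NavierStokesRegularity.Theorems.TaoLadderRungTwoBreakDSSWaveOfQuadTermDatum

/-!
# `WakeRatchet.EternalViscousRate` (stmt-NavierStokesRegularity-25647): RENORMALISATION of an ancient solution
# of the viscous lattice into an admissible eternal solution with covariant viscosity — brick 2b/3 of the
# bridge «`PerpetualPump.CircuitPump` witness ⟹ dissipation-balanced block-DSS bounded admissible eternal solution»

`WakeRatchetCritical.isEternal_recentre` (support file of ⟨23197⟩) turns a shell-wise solution of the AUTONOMOUS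
inviscid lattice on `t < 1` into an `IsEternal` solution.  This file is its VISCOUS, blow-up-time-`0` version and
its physical-variable front end:

* `isEternalVisc_of_critical` — a shell-wise solution `U` of the critical viscous lattice
  `U̇_n = Q(U_n) + Λ A(U_{n-1}) + Λ⁻¹ B(U_{n+1},U_n) - ν(1+ε₀)^{2n} U_n` on `t < 0` with `∫_{t<0}‖U_n‖ ≤ M` and
  `U_n` bounded on `[-1/2, 0)` gives the admissible eternal solution `W_n(σ) = e^{-σ} U_n(-e^{-σ})` with
  covariant viscosity `ν̂ = ν` (`IsEternalVisc ε₀ ν α W`: chain rule + degree-two homogeneity of `Q, A, B`; the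
  action by the change of variables `WakeRatchetCritical.integrable_recentre_iff`);
* `hasDerivAt_critical_of_physical` — Tao's physical viscous law `Ẋ_{i,n} = quadTerm - ν(1+ε₀)^{2n}X_{i,n}` on
  `t < 0` (two-sided, as produced by `PerpetualPump.CircuitPump` via the table dictionary
  `WakeRatchetCircuitPumpTable.rhsF_eq_quadTerm_sub`) gives the critical law for `U_n = Λ^n • x_n`
  (`DSSOneShift.shellVec_quadTerm_normalForm`);
* `isEternalVisc_of_ancient` — packaging: physical law on `(-∞,0)` + per-shell action `Λ^n∫_{t<0}‖x_n‖ ≤ M` +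
  boundedness of each shell near `0⁻` ⟹ `IsEternalVisc ε₀ ν α (Λ^n e^{-σ} x_n(-e^{-σ}))`;
  `uniformBound_of_clock` — the lattice type-I clock `Λ^n(-t)‖x_n(t)‖ ≤ K` (brick 1,
  `WakeRatchetCircuitPumpClock.typeI_clock_bound`) IS `UniformBound` of that family;
  `blockShift_of_dss` — exact self-similarity `x_{n+1}(Λ^{-4/5}t) = Λ^{-1/5}x_n(t)` IS the block-DSS relation
  `W_{n+1}(σ) = W_n(σ - 2 log(1+ε₀))` (lag pinned at `e^T = (1+ε₀)²`, as in `WakeRatchetViscDSS.viscBlockDSS_lag`).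

What then remains of the bridge is only the action clause for the pump (integrability of `‖x_n‖` on `(-∞,0)`:
a second damped round `|X_{i,n}(t)| ≲ (-t)^{-3/2}` in the far past plus `CircuitPumpNegative.typeI_critical_bound`
near `0`) and `InTableClass` of the zero-padded Toda table.  HONEST LABEL: MODEL lattice ODEs only (Tao 2016 §4,
§6.4); no item is closed; nothing here bears on the Navier–Stokes equations.
-/

noncomputable section

set_option linter.dupNamespace false

namespace Summit.NavierStokesRegularity.NavierStokesRegularity.Theorems

namespace WakeRatchetCircuitPumpRenorm

open Filter Topology MeasureTheory Set
open scoped RealInnerProductSpace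
open Literature.Analysis.FluidPDE Literature.Analysis.FluidPDE.TaoCascade
open WakeRatchetCritical DSSOneShift

variable {m : ℕ}

/-- **Critical viscous lattice on `t < 0` ⟹ admissible eternal solution with covariant viscosity.**  Let
`U : ℤ → ℝ → Em m` solve `U̇_n = Q(U_n) + Λ A(U_{n-1}) + Λ⁻¹ B(U_{n+1}, U_n) - ν(1+ε₀)^{2n} U_n` at every
`t < 0` (`ν ≥ 0`), with `∫_{t<0}‖U_n‖ ≤ M` for all `n` and every `U_n` bounded on `[-1/2, 0)`.  Then
`W_n(σ) := e^{-σ} • U_n(-e^{-σ})` satisfies `IsEternalVisc ε₀ ν α W` (blow-up time `0`; the dissipation becomes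
the covariant coefficient `ν(1+ε₀)^{2n}e^{-σ}`).
[cite: Tao2016AveragedNS, §4 Lemma 4.1 (4.8) and the viscous equation displayed before Thm. 4.2, §6.4; cell vocabulary (`IsEternalVisc`)] -/
theorem isEternalVisc_of_critical {ε₀ ν : ℝ} (hν : 0 ≤ ν) {α : Fin m → Fin m → Fin m → ℤ × ℤ × ℤ → ℝ}
    {U : ℤ → ℝ → Em m} {M : ℝ}
    (hU : ∀ (n : ℤ) (t : ℝ), t < 0 → HasDerivAt (U n)
      (tableQ α (U n t) + bigLam ε₀ • tableA α (U (n - 1) t)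
        + (bigLam ε₀)⁻¹ • tableB α (U (n + 1) t) (U n t) - (ν * (1 + ε₀) ^ ((2 : ℝ) * n)) • U n t) t)
    (hint : ∀ n : ℤ, IntegrableOn (fun t => ‖U n t‖) (Iio 0) ∧ ∫ t in Iio 0, ‖U n t‖ ≤ M)
    (hbd : ∀ n : ℤ, ∃ P : ℝ, ∀ t : ℝ, -(1 / 2) ≤ t → t < 0 → ‖U n t‖ ≤ P) :
    IsEternalVisc ε₀ ν α (fun n σ => Real.exp (-σ) • U n (0 - Real.exp (-σ))) := by
  refine ⟨fun n σ => ?_, hν, ⟨M, fun n => ?_⟩, fun n => ?_⟩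
  · -- the law: chain rule through `t = 0 - e^{-σ}` and homogeneity
    have hlt : 0 - Real.exp (-σ) < 0 := by linarith [Real.exp_pos (-σ)]
    have hexp : HasDerivAt (fun s : ℝ => Real.exp (-s)) (-Real.exp (-σ)) σ := by
      have h1 : HasDerivAt (fun s : ℝ => Real.exp (-s)) (Real.exp (-σ) * (-1)) σ :=
        (Real.hasDerivAt_exp (-σ)).comp σ ((hasDerivAt_id σ).neg)
      convert h1 using 1; ring
    have hcomp := (hU n _ hlt).scomp σ (hasDerivAt_sub_exp_neg 0 σ)
    have hder := hexp.smul hcomp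
    refine hder.congr_deriv ?_
    simp only [Function.comp_apply, tableQ_smul, tableA_smul, tableB_smul_smul, smul_add, smul_sub, smul_smul,
      neg_smul]
    module
  · -- the action: change of variables
    have h := integrable_recentre_iff (U n) 0
    exact ⟨h.1.2 (hint n).1, by rw [h.2 (hint n).1]; exact (hint n).2⟩
  · -- the forward bound: `e^{2σ} ‖W_n(σ)‖² = ‖U_n(-e^{-σ})‖²`, bounded for `σ ≥ log 2`
    obtain ⟨P, hP⟩ := hbd n
    refine ⟨Real.log 2, P ^ 2, fun σ hσ => ?_⟩
    have hle : Real.exp (-σ) ≤ 1 / 2 := by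
      have h1 : Real.exp (-σ) ≤ Real.exp (-Real.log 2) := Real.exp_le_exp.2 (by linarith)
      have h2 : Real.exp (-Real.log 2) = 1 / 2 := by
        rw [Real.exp_neg, Real.exp_log (by norm_num : (0:ℝ) < 2), one_div]
      linarith
    have ht1 : -(1 / 2) ≤ 0 - Real.exp (-σ) := by linarith
    have ht2 : 0 - Real.exp (-σ) < 0 := by linarith [Real.exp_pos (-σ)]
    have hPt := hP _ ht1 ht2
    have hw : Real.exp (2 * σ) * ‖Real.exp (-σ) • U n (0 - Real.exp (-σ))‖ ^ 2
        = ‖U n (0 - Real.exp (-σ))‖ ^ 2 := by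
      rw [norm_smul, Real.norm_eq_abs, abs_of_pos (Real.exp_pos _), mul_pow, ← mul_assoc,
        ← Real.exp_nat_mul, ← Real.exp_add]
      have : (2 : ℝ) * σ + ((2 : ℕ) : ℝ) * -σ = 0 := by push_cast; ring
      rw [this, Real.exp_zero, one_mul]
    rw [hw]
    exact pow_le_pow_left₀ (norm_nonneg _) hPt 2

/-- **Physical viscous law ⟹ critical law.**  If the scalar family `X` solves Tao's exact `ν`-viscous lattice
`Ẋ_{i,n} = quadTerm ε₀ α X i n - ν(1+ε₀)^{2n} X_{i,n}` at `t < 0` (two-sided derivative, every mode `i`), then the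
critical shell vector `U_n(t) = Λ^n • x_n(t)` solves `U̇_n = Q(U_n) + Λ A(U_{n-1}) + Λ⁻¹ B(U_{n+1},U_n) -
ν(1+ε₀)^{2n}U_n` at `t`.
[cite: Tao2016AveragedNS, §4 (4.1), Lemma 4.1 (4.8) and the viscous equation displayed before Thm. 4.2] -/
theorem hasDerivAt_critical_of_physical {ε₀ ν : ℝ} (hε : 0 < ε₀)
    {α : Fin m → Fin m → Fin m → ℤ × ℤ × ℤ → ℝ} {X : Fin m → ℤ → ℝ → ℝ} {n : ℤ} {t : ℝ}
    (hX : ∀ i : Fin m, HasDerivAt (X i n)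
      (quadTerm ε₀ α X i n t - ν * (1 + ε₀) ^ ((2 : ℝ) * n) * X i n t) t) :
    HasDerivAt (fun s => bigLam ε₀ ^ n • shellVec X n s)
      (tableQ α (bigLam ε₀ ^ n • shellVec X n t)
        + bigLam ε₀ • tableA α (bigLam ε₀ ^ (n - 1) • shellVec X (n - 1) t)
        + (bigLam ε₀)⁻¹ • tableB α (bigLam ε₀ ^ (n + 1) • shellVec X (n + 1) t) (bigLam ε₀ ^ n • shellVec X n t)
        - (ν * (1 + ε₀) ^ ((2 : ℝ) * n)) • (bigLam ε₀ ^ n • shellVec X n t)) t := by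
  have hb : (0 : ℝ) < 1 + ε₀ := by linarith
  have hΛ : 0 < bigLam ε₀ := bigLam_pos (by linarith)
  -- the shell vector's derivative, in normal form
  have hv : HasDerivWithinAt (shellVec X n)
      (WithLp.toLp 2 fun i => quadTerm ε₀ α X i n t - ν * (1 + ε₀) ^ ((2 : ℝ) * n) * X i n t) univ t :=
    hasDerivWithinAt_shellVec fun i => (hX i).hasDerivWithinAt
  have heq : (WithLp.toLp 2 fun i => quadTerm ε₀ α X i n t - ν * (1 + ε₀) ^ ((2 : ℝ) * n) * X i n t : Em m)
      = shellVec (fun i k s => quadTerm ε₀ α X i k s) n t - (ν * (1 + ε₀) ^ ((2 : ℝ) * n)) • shellVec X n t := by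
    ext i
    simp [shellVec, smul_eq_mul]
  rw [heq, shellVec_quadTerm_normalForm hb] at hv
  have hd : HasDerivAt (shellVec X n)
      (bigLam ε₀ ^ n • (tableQ α (shellVec X n t) + (bigLam ε₀)⁻¹ • tableA α (shellVec X (n - 1) t)
        + tableB α (shellVec X (n + 1) t) (shellVec X n t)) - (ν * (1 + ε₀) ^ ((2 : ℝ) * n)) • shellVec X n t) t :=
    hasDerivWithinAt_univ.1 hv
  refine (hd.const_smul (bigLam ε₀ ^ n)).congr_deriv ?_
  rw [tableQ_smul, tableA_smul, tableB_smul_smul]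
  have z1 : bigLam ε₀ ^ (n - 1) = bigLam ε₀ ^ n * (bigLam ε₀)⁻¹ := zpow_sub_one₀ hΛ.ne' n
  have z2 : bigLam ε₀ ^ (n + 1) = bigLam ε₀ ^ n * bigLam ε₀ := zpow_add_one₀ hΛ.ne' n
  rw [z1, z2]
  ext i
  simp only [PiLp.add_apply, PiLp.sub_apply, PiLp.smul_apply, smul_eq_mul]
  field_simp

/-- **Ancient physical solution ⟹ admissible eternal solution with covariant viscosity.**  Let `X` solve Tao's
exact `ν`-viscous lattice (`ν ≥ 0`, `ε₀ > 0`) at every `t < 0` for every mode and shell, with the uniform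
per-shell action `Λ^n ∫_{t<0}‖x_n‖ ≤ M` and every shell vector bounded on `[-1/2, 0)`.  Then the renormalised family
`W_n(σ) = Λ^n e^{-σ} x_n(-e^{-σ})` is an admissible eternal solution with covariant viscosity `ν̂ = ν`
(`IsEternalVisc ε₀ ν α W`, blow-up time `0`).
[cite: Tao2016AveragedNS, §4 Lemma 4.1 (4.8), the viscous equation before Thm. 4.2, §6.4 (self-similar variables); cell vocabulary (`IsEternalVisc`)] -/
theorem isEternalVisc_of_ancient {ε₀ ν : ℝ} (hε : 0 < ε₀) (hν : 0 ≤ ν)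
    {α : Fin m → Fin m → Fin m → ℤ × ℤ × ℤ → ℝ} {X : Fin m → ℤ → ℝ → ℝ} {M : ℝ}
    (hX : ∀ (i : Fin m) (n : ℤ) (t : ℝ), t < 0 →
      HasDerivAt (X i n) (quadTerm ε₀ α X i n t - ν * (1 + ε₀) ^ ((2 : ℝ) * n) * X i n t) t)
    (hact : ∀ n : ℤ, IntegrableOn (fun t => ‖shellVec X n t‖) (Iio 0) ∧
      bigLam ε₀ ^ n * ∫ t in Iio 0, ‖shellVec X n t‖ ≤ M)
    (hbd : ∀ n : ℤ, ∃ P : ℝ, ∀ t : ℝ, -(1 / 2) ≤ t → t < 0 → ‖shellVec X n t‖ ≤ P) :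
    IsEternalVisc ε₀ ν α (fun n σ => Real.exp (-σ) • (bigLam ε₀ ^ n • shellVec X n (0 - Real.exp (-σ)))) := by
  have hΛ : 0 < bigLam ε₀ := bigLam_pos (by linarith)
  have hΛn : ∀ n : ℤ, 0 < bigLam ε₀ ^ n := fun n => zpow_pos hΛ n
  refine isEternalVisc_of_critical (U := fun n s => bigLam ε₀ ^ n • shellVec X n s) (M := M) hν
    (fun n t ht => hasDerivAt_critical_of_physical hε fun i => hX i n t ht) (fun n => ?_) (fun n => ?_)
  · -- action: `‖Λ^n • x‖ = Λ^n ‖x‖`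
    have hn : ∀ t : ℝ, ‖bigLam ε₀ ^ n • shellVec X n t‖ = bigLam ε₀ ^ n * ‖shellVec X n t‖ := fun t => by
      rw [norm_smul, Real.norm_eq_abs, abs_of_pos (hΛn n)]
    simp only [hn]
    refine ⟨(hact n).1.const_mul _, ?_⟩
    rw [integral_const_mul]
    exact (hact n).2
  · obtain ⟨P, hP⟩ := hbd n
    refine ⟨bigLam ε₀ ^ n * P, fun t h1 h2 => ?_⟩
    show ‖bigLam ε₀ ^ n • shellVec X n t‖ ≤ bigLam ε₀ ^ n * P
    rw [norm_smul, Real.norm_eq_abs, abs_of_pos (hΛn n)]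
    exact mul_le_mul_of_nonneg_left (hP t h1 h2) (hΛn n).le

/-- **The lattice type-I clock IS `UniformBound` of the renormalised family.**  If
`Λ^n (-t) ‖x_n(t)‖ ≤ K` for all shells and all `t < 0` (the conclusion of brick 1,
`WakeRatchetCircuitPumpClock.typeI_clock_bound`, shell-vector form), then `W_n(σ) = Λ^n e^{-σ} x_n(-e^{-σ})` is
uniformly bounded.
[cite: Tao2016AveragedNS, §4 Thm. 4.2 (statement shape), §6.4; cell vocabulary (`UniformBound`)] -/
theorem uniformBound_of_clock {ε₀ : ℝ} (hε : 0 < ε₀) {X : Fin m → ℤ → ℝ → ℝ} {K : ℝ}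
    (hK : ∀ (n : ℤ) (t : ℝ), t < 0 → bigLam ε₀ ^ n * (-t) * ‖shellVec X n t‖ ≤ K) :
    UniformBound (fun n σ => Real.exp (-σ) • (bigLam ε₀ ^ n • shellVec X n (0 - Real.exp (-σ)))) := by
  have hΛ : 0 < bigLam ε₀ := bigLam_pos (by linarith)
  refine ⟨K, fun n σ => ?_⟩
  have ht : 0 - Real.exp (-σ) < 0 := by linarith [Real.exp_pos (-σ)]
  have h := hK n _ ht
  rw [norm_smul, norm_smul, Real.norm_eq_abs, Real.norm_eq_abs, abs_of_pos (Real.exp_pos _),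
    abs_of_pos (zpow_pos hΛ n)]
  have e : Real.exp (-σ) * (bigLam ε₀ ^ n * ‖shellVec X n (0 - Real.exp (-σ))‖) =
      bigLam ε₀ ^ n * (-(0 - Real.exp (-σ))) * ‖shellVec X n (0 - Real.exp (-σ))‖ := by ring
  rw [e]
  exact h

/-- **Exact self-similarity IS the block-DSS relation with the viscous lag.**  If the physical family is exactly
discretely self-similar with period one, `x_{n+1}(Λ^{-4/5} t) = Λ^{-1/5} x_n(t)` for `t < 0` (the DSS clause of
`PerpetualPump.CircuitPump`, `Λ = lam`), then the renormalised family repeats shell after shell with the log-time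
lag `T = (4/5) log Λ` (`= 2 log(1+ε₀)`, the lag pinned by covariance in `WakeRatchetViscDSS.viscBlockDSS_lag`):
`W_{n+1}(σ) = W_n(σ - T)`.
[cite: Tao2016AveragedNS, §4 (4.1) (scale covariance), §6.4; cell vocabulary (block-DSS eternal solutions)] -/
theorem blockShift_of_dss {ε₀ : ℝ} (hε : 0 < ε₀) {X : Fin m → ℤ → ℝ → ℝ}
    (hdss : ∀ (i : Fin m) (n : ℤ) (t : ℝ), t < 0 →
      X i (n + 1) (bigLam ε₀ ^ (-(4 / 5 : ℝ)) * t) = bigLam ε₀ ^ (-(1 / 5 : ℝ)) * X i n t)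
    (n : ℤ) (σ : ℝ) :
    (Real.exp (-σ) • (bigLam ε₀ ^ (n + 1) • shellVec X (n + 1) (0 - Real.exp (-σ))) : Em m) =
      Real.exp (-(σ - (4 / 5 : ℝ) * Real.log (bigLam ε₀))) •
        (bigLam ε₀ ^ n • shellVec X n (0 - Real.exp (-(σ - (4 / 5 : ℝ) * Real.log (bigLam ε₀))))) := by
  have hΛ : 0 < bigLam ε₀ := bigLam_pos (by linarith)
  -- the shifted time `t' = -e^{-(σ - T)} = -Λ^{4/5} e^{-σ}` and `e^{-(σ-T)} = Λ^{4/5} e^{-σ}`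
  have hT : Real.exp (-(σ - (4 / 5 : ℝ) * Real.log (bigLam ε₀))) = bigLam ε₀ ^ ((4 / 5 : ℝ)) * Real.exp (-σ) := by
    rw [show -(σ - (4 / 5 : ℝ) * Real.log (bigLam ε₀)) = (4 / 5 : ℝ) * Real.log (bigLam ε₀) + -σ by ring,
      Real.exp_add, Real.rpow_def_of_pos hΛ, mul_comm (Real.log (bigLam ε₀))]
  -- physical times: `t = -Λ^{4/5} e^{-σ}`, so that `Λ^{-4/5} t = -e^{-σ}`
  set t : ℝ := 0 - bigLam ε₀ ^ ((4 / 5 : ℝ)) * Real.exp (-σ) with htdef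
  have ht : t < 0 := by
    have := mul_pos (Real.rpow_pos_of_pos hΛ (4 / 5 : ℝ)) (Real.exp_pos (-σ)); linarith
  have hts : bigLam ε₀ ^ (-(4 / 5 : ℝ)) * t = 0 - Real.exp (-σ) := by
    rw [htdef, Real.rpow_neg hΛ.le]
    have h45ne : bigLam ε₀ ^ ((4 / 5 : ℝ)) ≠ 0 := (Real.rpow_pos_of_pos hΛ _).ne'
    field_simp
    ring
  have hvec : shellVec X (n + 1) (0 - Real.exp (-σ)) = bigLam ε₀ ^ (-(1 / 5 : ℝ)) • shellVec X n t := by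
    ext i
    simp only [shellVec_apply, PiLp.smul_apply, smul_eq_mul]
    rw [← hts]
    exact hdss i n t ht
  rw [hT, hvec]
  rw [show (0 : ℝ) - bigLam ε₀ ^ ((4 / 5 : ℝ)) * Real.exp (-σ) = t from rfl]
  simp only [smul_smul]
  congr 1
  have h : bigLam ε₀ ^ ((4 / 5 : ℝ)) = bigLam ε₀ * bigLam ε₀ ^ (-(1 / 5 : ℝ)) := by
    rw [show (4 / 5 : ℝ) = 1 + (-(1 / 5 : ℝ)) by norm_num, Real.rpow_add hΛ, Real.rpow_one]
  rw [zpow_add_one₀ hΛ.ne', h]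
  ring

end WakeRatchetCircuitPumpRenorm

end Summit.NavierStokesRegularity.NavierStokesRegularity.Theorems

end
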